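import Mathlib
import Summits.Ventures.PercRepro2.Defs
import Summits.Ventures.PercRepro2.Graph
import Summits.Ventures.PercRepro2.HullDefs
import Summits.Ventures.PercRepro2.LocRows
import Summits.Ventures.PercRepro2.SwRow
import Summits.Ventures.PercRepro2.SwAllRow
import Summits.Ventures.PercRepro2.SwSeriesDefs

/-!
# The series reduction of row 2′SW-ALL (blind cell PercRepro2, night-4 g5, 2026-08-24;
proofs/NIGHT4-BRIDGE.md §4)

`w ∉ {l, h, o}` a vertex of degree two with edges `e₁ = {w, u}`, `e₂ = {w, v}`.  By the colours of
`(e₁, e₂)` the set `Q(G)` splits into the same-colour part, which is `Q(G / w)` (the pair acts as the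
new edge `{u, v}` of its colour), and the mixed part, which is `Q(G − w) × {RB, BR}` (`w` is a dead
end in both colours).  The rigid permutations of `G / w` and `G − w` assemble to a rigid permutation
of `G`: on the same-colour part the pair takes the colour of the new edge in the image (when `u` lies
in the red cluster of `h`, the new edge is a red edge of that cluster and flips, so `e₁`, `e₂` turn
blue); on the mixed part the pair is swapped (`swAll_series`).  The reduction keeps the uniform
fibre: no weighted gadget is involved.
-/

namespace Summit.Ventures.PercRepro2

namespace Series

open Hull LocRows

open scoped Classical

variable {V : Type*} {E : Type*}
variable {ends : E → Sym2 V} {w u v : V} {e₁ e₂ : E}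

/-- A configuration of `G` from a configuration of `G − w` and the colours of `e₁`, `e₂`. -/
noncomputable def ofParts (e₁ e₂ : E) (η : Config (DelE e₁ e₂)) (c₁ c₂ : Bool) : Config E :=
  fun e => if h₁ : e = e₁ then c₁ else if h₂ : e = e₂ then c₂ else η ⟨e, h₁, h₂⟩

/-- The colour of `e₁`. -/
lemma ofParts_e₁ (e₁ e₂ : E) (η : Config (DelE e₁ e₂)) (c₁ c₂ : Bool) :
    ofParts e₁ e₂ η c₁ c₂ e₁ = c₁ := by simp [ofParts]

/-- The colour of `e₂`. -/
lemma ofParts_e₂ (e₁ e₂ : E) (hne : e₁ ≠ e₂) (η : Config (DelE e₁ e₂)) (c₁ c₂ : Bool) :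
    ofParts e₁ e₂ η c₁ c₂ e₂ = c₂ := by simp [ofParts, hne.symm]

/-- The restriction of `ofParts` is the given configuration. -/
lemma delConfig_ofParts (e₁ e₂ : E) (η : Config (DelE e₁ e₂)) (c₁ c₂ : Bool) :
    delConfig (e₁ := e₁) (e₂ := e₂) (ofParts e₁ e₂ η c₁ c₂) = η := by
  funext e
  simp [delConfig, ofParts, e.2.1, e.2.2]

/-- A configuration is `ofParts` of its restriction and its colours of `e₁`, `e₂`. -/
lemma ofParts_delConfig (ζ : Config E) :
    ofParts e₁ e₂ (delConfig (e₁ := e₁) (e₂ := e₂) ζ) (ζ e₁) (ζ e₂) = ζ := by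
  funext e
  by_cases h₁ : e = e₁
  · subst h₁; simp [ofParts]
  by_cases h₂ : e = e₂
  · subst h₂; simp [ofParts, h₁]
  · simp [ofParts, h₁, h₂, delConfig]

/-- With the new edge blue, the clusters of `G / w` are those of `G − w`. -/
lemma cluster_con_false (ζ : Config E) (x : V) :
    cluster (conEnds ends u v e₁ e₂) (conConfig (e₁ := e₁) (e₂ := e₂) ζ false) x =
      cluster (delEnds ends e₁ e₂) (delConfig ζ) x := by
  apply Set.Subset.antisymm
  · intro y hy
    refine mem_of_conn_of_closed (ends := conEnds ends u v e₁ e₂) (ω := conConfig ζ false) ?_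
      (mem_cluster_self _ _ _) hy
    intro a ha b hab
    rcases adj_con_cases hab with h | ⟨hc, _⟩
    · exact mem_cluster_of_adj ha h
    · exact absurd hc Bool.false_ne_true
  · intro y hy
    refine mem_of_conn_of_closed (ends := delEnds ends e₁ e₂) (ω := delConfig ζ) ?_
      (mem_cluster_self _ _ _) hy
    intro a ha b hab
    exact mem_cluster_of_adj ha (adj_con_of_del hab)

/-- The clusters of `G / w` with the new edge of colour `c`, written uniformly: with `c = true` the
contracted cluster, with `c = false` the deleted cluster. -/
lemma cluster_same_general (hd : IsDeg2 ends w u v e₁ e₂) {ζ : Config E} {c : Bool}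
    (h₁ : ζ e₁ = c) (h₂ : ζ e₂ = c) {x : V} (hx : x ≠ w) {y : V} (hy : y ≠ w) :
    y ∈ cluster ends ζ x ↔
      y ∈ cluster (conEnds ends u v e₁ e₂) (conConfig (e₁ := e₁) (e₂ := e₂) ζ c) x := by
  cases c with
  | true =>
    rw [cluster_same_eq hd h₁ h₂ hx]
    simp only [Set.mem_union, Set.mem_setOf_eq]
    constructor
    · rintro (h | ⟨hyw, _⟩)
      · exact h
      · exact absurd hyw hy
    · exact Or.inl
  | false =>
    rw [cluster_same_other_eq hd h₁ h₂, cluster_con_false]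

/-- In the mixed case the clusters of `G` and of `G − w` agree away from `w`. -/
lemma cluster_mixed_general (hd : IsDeg2 ends w u v e₁ e₂) {ζ : Config E} (hmix : ζ e₁ ≠ ζ e₂)
    {x : V} (hx : x ≠ w) {y : V} (hy : y ≠ w) :
    y ∈ cluster ends ζ x ↔ y ∈ cluster (delEnds ends e₁ e₂) (delConfig ζ) x := by
  rw [cluster_mixed_eq hd hmix hx]
  simp only [Set.mem_union, Set.mem_setOf_eq]
  constructor
  · rintro (h | ⟨hyw, _⟩)
    · exact h
    · exact absurd hyw hy
  · exact Or.inl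

/-- An edge of `G` other than `e₁`, `e₂` inside a set `S` is an edge of `G − w` inside `S ∖ {w}`. -/
lemma mem_within_del (hd : IsDeg2 ends w u v e₁ e₂) {S : Set V} {e : E} (h₁ : e ≠ e₁) (h₂ : e ≠ e₂)
    (he : e ∈ within ends S) :
    (⟨e, h₁, h₂⟩ : DelE e₁ e₂) ∈ within (delEnds ends e₁ e₂) {y | y ∈ S ∧ y ≠ w} := by
  obtain ⟨x, hx, y, hy, hends⟩ := he
  have hw := not_mem_ends_of_ne hd h₁ h₂
  rw [hends] at hw
  refine ⟨x, ⟨hx, ?_⟩, y, ⟨hy, ?_⟩, hends⟩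
  · intro hxw; apply hw; rw [hxw]; exact Sym2.mem_mk_left w y
  · intro hyw; apply hw; rw [hyw]; exact Sym2.mem_mk_right x w

/-- An edge of `G − w` inside a set is an edge of `G / w` inside it. -/
lemma mem_within_con {S : Set V} {e : DelE e₁ e₂} (he : e ∈ within (delEnds ends e₁ e₂) S) :
    (Sum.inl e : DelE e₁ e₂ ⊕ Unit) ∈ within (conEnds ends u v e₁ e₂) S := he

variable [Fintype E] [DecidableEq E]

/-- **`Q` in the same-colour case**: `ζ ∈ Q(G)` iff the contracted configuration lies in `Q(G / w)`. -/
theorem mem_tgtU_same_iff (hd : IsDeg2 ends w u v e₁ e₂) {l h o : V} (hl : l ≠ w) (hh : h ≠ w)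
    (ho : o ≠ w) {ζ : Config E} {c : Bool} (h₁ : ζ e₁ = c) (h₂ : ζ e₂ = c) :
    ζ ∈ tgtU ends l h {S : Set V | o ∈ S} ↔
      conConfig (e₁ := e₁) (e₂ := e₂) ζ c ∈ tgtU (conEnds ends u v e₁ e₂) l h {S : Set V | o ∈ S} := by
  have hb₁ : blue ζ e₁ = !c := by rw [blue_apply, h₁]
  have hb₂ : blue ζ e₂ = !c := by rw [blue_apply, h₂]
  simp only [tgtU, Finset.mem_filter, Finset.mem_univ, true_and, hull, Set.mem_union,
    Set.mem_setOf_eq, not_or]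
  rw [← conConfig_blue, cluster_same_general hd h₁ h₂ hl hh, cluster_same_general hd hb₁ hb₂ hl hh,
    cluster_same_general hd h₁ h₂ hl ho, cluster_same_general hd hb₁ hb₂ hl ho]

/-- **`Q` in the mixed case**: `ζ ∈ Q(G)` iff the restriction lies in `Q(G − w)`. -/
theorem mem_tgtU_mixed_iff (hd : IsDeg2 ends w u v e₁ e₂) {l h o : V} (hl : l ≠ w) (hh : h ≠ w)
    (ho : o ≠ w) {ζ : Config E} (hmix : ζ e₁ ≠ ζ e₂) :
    ζ ∈ tgtU ends l h {S : Set V | o ∈ S} ↔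
      delConfig (e₁ := e₁) (e₂ := e₂) ζ ∈ tgtU (delEnds ends e₁ e₂) l h {S : Set V | o ∈ S} := by
  have hbmix : blue ζ e₁ ≠ blue ζ e₂ := by
    simp only [blue_apply]; intro hc; apply hmix
    exact Bool.not_inj hc
  simp only [tgtU, Finset.mem_filter, Finset.mem_univ, true_and, hull, Set.mem_union,
    Set.mem_setOf_eq, not_or]
  rw [← delConfig_blue, cluster_mixed_general hd hmix hl hh, cluster_mixed_general hd hbmix hl hh,
    cluster_mixed_general hd hmix hl ho, cluster_mixed_general hd hbmix hl ho]

/-- **The series reduction of row 2′SW-ALL**: the rigid row on `G − w` and on `G / w` gives the rigid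
row on `G`, for every placement of the marks off `w`. -/
theorem swAll_series (hd : IsDeg2 ends w u v e₁ e₂) {l h o : V} (hl : l ≠ w) (hh : h ≠ w)
    (ho : o ≠ w) (hdel : SwAll (delEnds ends e₁ e₂) l h o)
    (hcon : SwAll (conEnds ends u v e₁ e₂) l h o) : SwAll ends l h o := by
  obtain ⟨fd, hfd, hmemd⟩ := hdel
  obtain ⟨fc, hfc, hmemc⟩ := hcon
  -- the image of a same-colour configuration
  let Φs : {ζ // ζ ∈ tgtU ends l h {S : Set V | o ∈ S}} → Config E := fun x =>
    if hs : x.1 e₁ = x.1 e₂ then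
      let η := fc ⟨conConfig x.1 (x.1 e₁), (mem_tgtU_same_iff hd hl hh ho rfl hs.symm).1 x.2⟩
      ofParts e₁ e₂ (η ∘ Sum.inl) (η (Sum.inr ())) (η (Sum.inr ()))
    else
      let η := fd ⟨delConfig x.1, (mem_tgtU_mixed_iff hd hl hh ho hs).1 x.2⟩
      ofParts e₁ e₂ η (x.1 e₂) (x.1 e₁)
  refine ⟨Φs, ?_, ?_⟩
  · -- injectivity
    intro x y hxy
    by_cases hsx : x.1 e₁ = x.1 e₂ <;> by_cases hsy : y.1 e₁ = y.1 e₂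
    · -- both same-colour
      simp only [Φs, dif_pos hsx, dif_pos hsy] at hxy
      set ηx := fc ⟨conConfig x.1 (x.1 e₁), (mem_tgtU_same_iff hd hl hh ho rfl hsx.symm).1 x.2⟩
      set ηy := fc ⟨conConfig y.1 (y.1 e₁), (mem_tgtU_same_iff hd hl hh ho rfl hsy.symm).1 y.2⟩
      have hl' : ηx ∘ Sum.inl = ηy ∘ Sum.inl := by
        have := congrArg (delConfig (e₁ := e₁) (e₂ := e₂)) hxy
        rwa [delConfig_ofParts, delConfig_ofParts] at this
      have hr' : ηx (Sum.inr ()) = ηy (Sum.inr ()) := by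
        have := congrFun hxy e₁
        rwa [ofParts_e₁, ofParts_e₁] at this
      have hη : ηx = ηy := by
        funext e; rcases e with e | e
        · exact congrFun hl' e
        · exact hr'
      have hc := hfc hη
      have hc' := congrArg Subtype.val hc
      simp only at hc'
      -- the contracted configurations agree, hence the colours and the restrictions
      have hcol : x.1 e₁ = y.1 e₁ := congrFun hc' (Sum.inr ())
      have hres : delConfig (e₁ := e₁) (e₂ := e₂) x.1 = delConfig y.1 := by
        funext e; exact congrFun hc' (Sum.inl e)
      apply Subtype.ext
      calc x.1 = ofParts e₁ e₂ (delConfig x.1) (x.1 e₁) (x.1 e₂) := (ofParts_delConfig x.1).symm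
        _ = ofParts e₁ e₂ (delConfig y.1) (y.1 e₁) (y.1 e₂) := by rw [hres, ← hsx, hcol, hsy]
        _ = y.1 := ofParts_delConfig y.1
    · -- `x` same-colour, `y` mixed: the images differ at `(e₁, e₂)`
      exfalso
      simp only [Φs, dif_pos hsx, dif_neg hsy] at hxy
      have h1 := congrFun hxy e₁
      have h2 := congrFun hxy e₂
      rw [ofParts_e₁, ofParts_e₁] at h1
      rw [ofParts_e₂ _ _ hd.ne, ofParts_e₂ _ _ hd.ne] at h2
      exact hsy (h2.symm.trans h1 ▸ rfl)
    · exfalso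
      simp only [Φs, dif_neg hsx, dif_pos hsy] at hxy
      have h1 := congrFun hxy e₁
      have h2 := congrFun hxy e₂
      rw [ofParts_e₁, ofParts_e₁] at h1
      rw [ofParts_e₂ _ _ hd.ne, ofParts_e₂ _ _ hd.ne] at h2
      exact hsx (h1.trans h2.symm ▸ rfl)
    · -- both mixed
      simp only [Φs, dif_neg hsx, dif_neg hsy] at hxy
      have hres : fd ⟨delConfig x.1, (mem_tgtU_mixed_iff hd hl hh ho hsx).1 x.2⟩ =
          fd ⟨delConfig y.1, (mem_tgtU_mixed_iff hd hl hh ho hsy).1 y.2⟩ := by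
        have := congrArg (delConfig (e₁ := e₁) (e₂ := e₂)) hxy
        rwa [delConfig_ofParts, delConfig_ofParts] at this
      have hd' := congrArg Subtype.val (hfd hres)
      simp only at hd'
      have h1 := congrFun hxy e₁
      have h2 := congrFun hxy e₂
      rw [ofParts_e₁, ofParts_e₁] at h1
      rw [ofParts_e₂ _ _ hd.ne, ofParts_e₂ _ _ hd.ne] at h2
      apply Subtype.ext
      calc x.1 = ofParts e₁ e₂ (delConfig x.1) (x.1 e₁) (x.1 e₂) := (ofParts_delConfig x.1).symm
        _ = ofParts e₁ e₂ (delConfig y.1) (y.1 e₁) (y.1 e₂) := by rw [hd', h1, h2]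
        _ = y.1 := ofParts_delConfig y.1
  · intro x
    by_cases hs : x.1 e₁ = x.1 e₂
    · -- same-colour: the image is in `Q` through the contracted row, and the rigid property
      have hx' := (mem_tgtU_same_iff hd hl hh ho rfl hs.symm).1 x.2
      obtain ⟨hmem, hflip⟩ := hmemc ⟨conConfig x.1 (x.1 e₁), hx'⟩
      set η := fc ⟨conConfig x.1 (x.1 e₁), hx'⟩ with hη
      have hΦ : Φs x = ofParts e₁ e₂ (η ∘ Sum.inl) (η (Sum.inr ())) (η (Sum.inr ())) := by
        simp only [Φs, dif_pos hs]; rfl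
      rw [hΦ]
      have hcon_img : conConfig (e₁ := e₁) (e₂ := e₂)
          (ofParts e₁ e₂ (η ∘ Sum.inl) (η (Sum.inr ())) (η (Sum.inr ()))) (η (Sum.inr ())) = η := by
        funext e; rcases e with e | e
        · show delConfig (ofParts e₁ e₂ (η ∘ Sum.inl) _ _) e = η (Sum.inl e)
          rw [delConfig_ofParts]; rfl
        · rfl
      refine ⟨?_, ?_⟩
      · rw [mem_tgtU_same_iff hd hl hh ho (ofParts_e₁ _ _ _ _ _) (ofParts_e₂ _ _ hd.ne _ _ _), hcon_img]
        exact hmem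
      · intro e he hred
        by_cases h₁ : e = e₁
        · -- `e₁` red inside the red cluster of `h`: `w, u ∈ C_R(h)`, so the new edge is a red edge of
          -- the contracted cluster and flips
          rw [h₁] at he hred ⊢
          rw [ofParts_e₁]
          have hc : x.1 e₁ = true := hred
          obtain ⟨a, ha, b, hb, hends⟩ := he
          rw [hd.ends₁] at hends
          have hu : u ∈ cluster ends x.1 h := by
            rcases Sym2.eq_iff.1 hends with ⟨_, hbu⟩ | ⟨_, hau⟩
            · rw [hbu]; exact hb
            · rw [hau]; exact ha
          have hu' : u ∈ cluster (conEnds ends u v e₁ e₂) (conConfig x.1 (x.1 e₁)) h :=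
            (cluster_same_general hd rfl hs.symm hh hd.wu.symm).1 hu
          have hv' : v ∈ cluster (conEnds ends u v e₁ e₂) (conConfig x.1 (x.1 e₁)) h := by
            rw [hc] at hu' ⊢
            exact mem_cluster_of_adj hu' (adj_con_uv hd x.1)
          have hin : (Sum.inr () : DelE e₁ e₂ ⊕ Unit) ∈
              within (conEnds ends u v e₁ e₂) (cluster (conEnds ends u v e₁ e₂) (conConfig x.1 (x.1 e₁)) h) :=
            ⟨u, hu', v, hv', rfl⟩
          have := hflip (Sum.inr ()) hin (by show x.1 e₁ = true; exact hc)
          exact this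
        by_cases h₂ : e = e₂
        · rw [h₂] at he hred ⊢
          rw [ofParts_e₂ _ _ hd.ne]
          have hc : x.1 e₂ = true := hred
          have hc₁ : x.1 e₁ = true := hs.trans hc
          obtain ⟨a, ha, b, hb, hends⟩ := he
          rw [hd.ends₂] at hends
          have hv : v ∈ cluster ends x.1 h := by
            rcases Sym2.eq_iff.1 hends with ⟨_, hbv⟩ | ⟨_, hav⟩
            · rw [hbv]; exact hb
            · rw [hav]; exact ha
          have hv' : v ∈ cluster (conEnds ends u v e₁ e₂) (conConfig x.1 (x.1 e₁)) h :=
            (cluster_same_general hd rfl hs.symm hh hd.wv.symm).1 hv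
          have hu' : u ∈ cluster (conEnds ends u v e₁ e₂) (conConfig x.1 (x.1 e₁)) h := by
            rw [hc₁] at hv' ⊢
            exact mem_cluster_of_adj hv' (adj_con_uv hd x.1).symm
          have hin : (Sum.inr () : DelE e₁ e₂ ⊕ Unit) ∈
              within (conEnds ends u v e₁ e₂) (cluster (conEnds ends u v e₁ e₂) (conConfig x.1 (x.1 e₁)) h) :=
            ⟨u, hu', v, hv', rfl⟩
          exact hflip (Sum.inr ()) hin (by show x.1 e₁ = true; exact hc₁)
        · -- an old edge: the rigid property of the contracted row
          have hin := mem_within_del hd h₁ h₂ he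
          have hin' : (Sum.inl ⟨e, h₁, h₂⟩ : DelE e₁ e₂ ⊕ Unit) ∈ within (conEnds ends u v e₁ e₂)
              (cluster (conEnds ends u v e₁ e₂) (conConfig x.1 (x.1 e₁)) h) := by
            refine mem_within_con ?_
            obtain ⟨a, ⟨ha, haw⟩, b, ⟨hb, hbw⟩, hends⟩ := hin
            exact ⟨a, (cluster_same_general hd rfl hs.symm hh haw).1 ha, b,
              (cluster_same_general hd rfl hs.symm hh hbw).1 hb, hends⟩
          have := hflip (Sum.inl ⟨e, h₁, h₂⟩) hin' (by show x.1 e = true; exact hred)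
          show ofParts e₁ e₂ (η ∘ Sum.inl) _ _ e = false
          simp only [ofParts, dif_neg h₁, dif_neg h₂]
          exact this
    · -- mixed: the image is in `Q` through the deleted row, and the rigid property
      have hx' := (mem_tgtU_mixed_iff hd hl hh ho hs).1 x.2
      obtain ⟨hmem, hflip⟩ := hmemd ⟨delConfig x.1, hx'⟩
      set η := fd ⟨delConfig x.1, hx'⟩ with hη
      have hΦ : Φs x = ofParts e₁ e₂ η (x.1 e₂) (x.1 e₁) := by
        simp only [Φs, dif_neg hs]; rfl
      rw [hΦ]
      have hmix' : ofParts e₁ e₂ η (x.1 e₂) (x.1 e₁) e₁ ≠ ofParts e₁ e₂ η (x.1 e₂) (x.1 e₁) e₂ := by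
        rw [ofParts_e₁, ofParts_e₂ _ _ hd.ne]; exact fun h => hs h.symm
      refine ⟨?_, ?_⟩
      · rw [mem_tgtU_mixed_iff hd hl hh ho hmix', delConfig_ofParts]
        exact hmem
      · intro e he hred
        by_cases h₁ : e = e₁
        · -- `e₁` red: the pair is swapped, so `e₁` takes the colour of `e₂`, which is blue
          rw [h₁] at hred ⊢
          rw [ofParts_e₁]
          have hc : x.1 e₁ = true := hred
          rcases hb : x.1 e₂ with _ | _
          · rfl
          · exact absurd (hc.trans hb.symm) hs
        by_cases h₂ : e = e₂
        · rw [h₂] at hred ⊢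
          rw [ofParts_e₂ _ _ hd.ne]
          have hc : x.1 e₂ = true := hred
          rcases hb : x.1 e₁ with _ | _
          · rfl
          · exact absurd (hb.trans hc.symm) hs
        · have hin := mem_within_del hd h₁ h₂ he
          have hin' : (⟨e, h₁, h₂⟩ : DelE e₁ e₂) ∈ within (delEnds ends e₁ e₂)
              (cluster (delEnds ends e₁ e₂) (delConfig x.1) h) := by
            obtain ⟨a, ⟨ha, haw⟩, b, ⟨hb, hbw⟩, hends⟩ := hin
            exact ⟨a, (cluster_mixed_general hd hs hh haw).1 ha, b,
              (cluster_mixed_general hd hs hh hbw).1 hb, hends⟩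
          have := hflip ⟨e, h₁, h₂⟩ hin' (by show x.1 e = true; exact hred)
          show ofParts e₁ e₂ η _ _ e = false
          simp only [ofParts, dif_neg h₁, dif_neg h₂]
          exact this

end Series

end Summit.Ventures.PercRepro2
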